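import Summits.AtomisticToContinuum.BoseEinsteinCondensation.Theorems.PuffFloor.Negative.PuffFloorFalseWithoutMinimality
import HarnessLib

/-!
# `PuffFloor` fails for near-minimisers at every energy resolution (negative lemma for crux `PuffFloor`, stmt-AtomisticToContinuum-11785)

Fourth file of the refuter's negative-side chain for crux `PuffFloor` of route
`BECConjugateDomination`. A natural STRENGTHENING of the crux is refuted:

* `PuffFloorNearMinimisers` — exact minimality weakened to the weakest near-minimiser form
  (`periodicEnergy v Ψ ≤ E₀^per + δ` with `∃ δ > 0` chosen AFTER `n`, exactly the energy window
  of the route's target `SmoothPeriodicBEC`), everything else verbatim;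
* `puffFloor_false_for_nearMinimisers : ¬ PuffFloorNearMinimisers`. For the free gas
  (`E₀^per = 0`), every `C ≥ 0`, `ρ`, `N ≥ 2` and every `δ > 0`: the witness `Ψ_ε`, `ε = η/N²`,
  at the mode `k = (2π/L)(j,0,0)` with `j = ⌊√(Cρ/(εn))/(2π/L)⌋ + 1` has
  `periodicEnergy ≤ 2ε²N³k² ≤ η(8Cρ + 4(2π/L)²) < δ` for `η` small, yet `S_m = 1 - εn` lies
  strictly below the floor (`Cρ < k²·εn`, `floor_contradiction`). The energy cost of violating the
  floor decays like `1/k²` along high modes: the floor is a property of the EXACT minimiser only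
  and admits no proof by energy-closeness or compactness. Consistent with the route, where
  near-minimisers enter `IMUChainGlue` through `NearMinimiserStability` on `n₀`, never through `S`.

No Theses statement is asserted positively. All `[folklore]`.
-/

noncomputable section

namespace Summit.AtomisticToContinuum.BoseEinsteinCondensation.Theorems.PuffFloor.Negative

open Literature.MathematicalPhysics.QuantumManyBody.BoseGas MeasureTheory Complex Finset
open scoped ComplexConjugate BigOperators ENNReal NNReal

variable {N : ℕ} {L : ℝ}

/-! ### Near-minimisers: the floor fails at arbitrarily small excitation energy -/

/-- `PuffFloor` with exact minimality WEAKENED to near-minimality in the weakest form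
(`periodicEnergy v Ψ ≤ E₀^per + δ` with `∃ δ > 0` chosen AFTER `n`, as in `SmoothPeriodicBEC`),
all else verbatim. -/
def PuffFloorNearMinimisers : Prop :=
  ∀ v : ℝ → ENNReal, IsRepulsiveFiniteRange v → (∀ r, v r ≠ ⊤) →
    ContDiff ℝ 2 (fun x : Space => (v ‖x‖).toReal) →
    (∃ Cₑ : ℝ, ∀ x : Space, ‖iteratedFDeriv ℝ 2 (fun x : Space => (v ‖x‖).toReal) x‖ ≤
      Cₑ * Real.sqrt ((v ‖x‖).toReal)) →
    ∃ C : ℝ, 0 ≤ C ∧ ∃ ρ₀ : ℝ, 0 < ρ₀ ∧ ∀ ρ : ℝ, 0 < ρ → ρ < ρ₀ →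
      ∀ᶠ n : ℕ in Filter.atTop, ∃ δ : ENNReal, 0 < δ ∧
        ∀ Ψ : PeriodicTrialState (n + 1) (sideLength ρ (n + 1)),
        (let L : ℝ := sideLength ρ (n + 1)
         let S : (Fin 3 → ℤ) → ℝ := fun m => ((n : ℝ) + 1)⁻¹ *
           ∫ X in cellN (n + 1) L, ‖∑ j : Fin (n + 1), cellWave L m (X j)‖ ^ 2 * ‖Ψ.ψ X‖ ^ 2
         let kn : (Fin 3 → ℤ) → ℝ := fun m => ‖((2 * Real.pi / L) • latticeVec 1 m)‖
         periodicEnergy v Ψ ≤ periodicGroundStateEnergy v (n + 1) L + δ → periodicEnergy v Ψ ≠ ⊤ →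
           (∀ X, Ψ.ψ X = (‖Ψ.ψ X‖ : ℂ)) → (∀ X, Ψ.ψ X ≠ 0) →
           ∀ m : Fin 3 → ℤ, m ≠ 0 → kn m / Real.sqrt (kn m ^ 2 + C * ρ) ≤ S m)

/-- `S_m` of the witness in the syntactic form of the crux (`N = n + 1`): `S_m = 1 - ε n`.
[folklore] -/
theorem structureFactor_witnessState_succ' (hL : 0 < L) (n : ℕ) {ε : ℝ} (hε : 0 ≤ ε)
    (hε' : ε * ((((n + 1 : ℕ) : ℝ)) ^ 2 - ((n + 1 : ℕ) : ℝ)) ≤ 1 / 2) {m : Fin 3 → ℤ}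
    (hm : m ≠ 0) :
    ((n : ℝ) + 1)⁻¹ * ∫ X in cellN (n + 1) L, ‖∑ j : Fin (n + 1), cellWave L m (X j)‖ ^ 2 *
        ‖(witnessState hε hε' hL hm).ψ X‖ ^ 2 = 1 - ε * n := by
  have h := structureFactor_witnessState hε hε' hL (Nat.succ_pos n) hm
  push_cast at h
  rw [add_sub_cancel_right] at h
  exact h

/-- `k ≤ s + c ⇒ k² ≤ 2s² + 2c²` for `k ≥ 0`. [folklore] -/
theorem sq_le_two_sq_add_two_sq {k s c : ℝ} (hk : 0 ≤ k) (h : k ≤ s + c) :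
    k ^ 2 ≤ 2 * s ^ 2 + 2 * c ^ 2 := by
  nlinarith [sq_nonneg (s - c)]

/-- `n ≤ (n+1)²`. [folklore] -/
theorem le_succ_sq (n : ℝ) (hn : 0 ≤ n) : n ≤ (n + 1) ^ 2 := by nlinarith [sq_nonneg n]

/-- The algebra of the contradiction: `k/√(k²+Cρ) ≤ 1 - δ` (squared) and `Cρ < k²δ` are
incompatible for `0 < δ < 1`. [folklore] -/
theorem floor_contradiction {k δ Cρ : ℝ} (hk : 0 < k) (hδ0 : 0 < δ) (hδ1 : δ < 1) (hCρ0 : 0 ≤ Cρ)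
    (hCρ : Cρ < k ^ 2 * δ) (h3 : k ^ 2 ≤ (1 - δ) ^ 2 * (k ^ 2 + Cρ)) : False := by
  have hA : (1 - δ) ^ 2 * Cρ ≤ Cρ :=
    mul_le_of_le_one_left hCρ0 (by nlinarith)
  have h4 : k ^ 2 * δ * (2 - δ) ≤ Cρ := by
    have e : k ^ 2 * δ * (2 - δ) = k ^ 2 - (1 - δ) ^ 2 * k ^ 2 := by ring
    rw [e]
    linarith [mul_add ((1 - δ) ^ 2) (k ^ 2) Cρ]
  have h5 : 0 < k ^ 2 * δ * (1 - δ) := mul_pos (mul_pos (pow_pos hk 2) hδ0) (by linarith)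
  have e2 : k ^ 2 * δ * (2 - δ) = k ^ 2 * δ + k ^ 2 * δ * (1 - δ) := by ring
  linarith

/-- **The floor fails for near-minimisers at every energy resolution.** `PuffFloorNearMinimisers`
is FALSE: for the free gas (`E₀^per = 0`), every `C ≥ 0`, `ρ > 0`, `N ≥ 2` and every `δ > 0` the
witness `Ψ_ε` with `ε = η/N²` at a high mode `k = (2π/L)(j,0,0)`, `k² ≈ Cρ/(εn)`, has
`periodicEnergy ≤ 2ε²N³k² ≤ η(8Cρ + 16π²/L²) < δ` for `η` small, yet `S_m = 1 - εn` lies below the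
floor (`Cρ < k²·εn`). The energy cost of violating the floor decays like `1/k²` along high modes, so
the floor is a property of the EXACT minimiser only (consistent with the route: near-minimisers enter
`IMUChainGlue` through `NearMinimiserStability` on `n₀`, never through `S`). [folklore] -/
theorem puffFloor_false_for_nearMinimisers : ¬ PuffFloorNearMinimisers := by
  intro h
  obtain ⟨h1, h2, h3, h4⟩ := smoothClass_zero
  obtain ⟨C, hC, ρ₀, hρ₀, h⟩ := h 0 h1 h2 h3 h4
  set ρ : ℝ := ρ₀ / 2 with hρdef
  have hρ : 0 < ρ := by positivity
  have hev := h ρ hρ (by rw [hρdef]; linarith)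
  rw [Filter.eventually_atTop] at hev
  obtain ⟨n₀, hn₀⟩ := hev
  set n : ℕ := max n₀ 1 with hndef
  have h1n : 1 ≤ n := le_max_right _ _
  have hn' : (1 : ℝ) ≤ n := by exact_mod_cast h1n
  obtain ⟨δ', hδ'0, key⟩ := hn₀ n (le_max_left _ _)
  set L : ℝ := sideLength ρ (n + 1) with hLdef
  have hL : 0 < L := Real.rpow_pos_of_pos (by positivity) _
  clear_value L n ρ
  -- a real energy budget `δr` below `δ'`
  obtain ⟨δr, hδr, hδr'⟩ : ∃ δr : ℝ, 0 < δr ∧ ENNReal.ofReal δr ≤ δ' := by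
    rcases eq_or_ne δ' ⊤ with htop | htop
    · exact ⟨1, one_pos, htop ▸ le_top⟩
    · exact ⟨δ'.toReal, ENNReal.toReal_pos hδ'0.ne' htop, ENNReal.ofReal_toReal_le⟩
  -- the small parameter `η` and the amplitude `ε = η / N²` (all constants opaque)
  obtain ⟨c₀, hc₀⟩ : ∃ c₀ : ℝ, c₀ = 2 * Real.pi / L := ⟨_, rfl⟩
  have hc₀0 : 0 < c₀ := by rw [hc₀]; positivity
  obtain ⟨A, hA⟩ : ∃ A : ℝ, A = 8 * C * ρ + 4 * c₀ ^ 2 := ⟨_, rfl⟩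
  have hA0 : 0 < A := by rw [hA]; positivity
  obtain ⟨η, hηdef⟩ : ∃ η : ℝ, η = min (1 / 2) (δr / (2 * A)) := ⟨_, rfl⟩
  have hη0 : 0 < η := by rw [hηdef]; exact lt_min (by norm_num) (by positivity)
  have hη1 : η ≤ 1 / 2 := by rw [hηdef]; exact min_le_left _ _
  have hηA : η * A ≤ δr / 2 := by
    have : η ≤ δr / (2 * A) := by rw [hηdef]; exact min_le_right _ _
    rw [le_div_iff₀ (by positivity)] at this
    linarith
  obtain ⟨ε, hεdef⟩ : ∃ ε : ℝ, ε = η / ((n : ℝ) + 1) ^ 2 := ⟨_, rfl⟩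
  have hε0 : 0 ≤ ε := by rw [hεdef]; positivity
  have hεN : ε * ((n : ℝ) + 1) ^ 2 = η := by rw [hεdef]; field_simp
  have hεa : ε * ((((n + 1 : ℕ) : ℝ)) ^ 2 - ((n + 1 : ℕ) : ℝ)) ≤ 1 / 2 := by
    push_cast
    have e : ε * (((n : ℝ) + 1) ^ 2 - ((n : ℝ) + 1)) = ε * ((n : ℝ) + 1) ^ 2 - ε * ((n : ℝ) + 1) := by
      ring
    have hpos : 0 ≤ ε * ((n : ℝ) + 1) := by positivity
    rw [e, hεN]
    linarith
  -- the deficit `δ = ε n` of the witness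
  obtain ⟨δ, hδdef⟩ : ∃ δ : ℝ, δ = ε * n := ⟨_, rfl⟩
  have hδ0 : 0 < δ := by
    rw [hδdef]; exact mul_pos (by rw [hεdef]; positivity) (by positivity)
  have hδ1 : δ < 1 := by
    have : δ ≤ ε * ((n : ℝ) + 1) ^ 2 := by
      rw [hδdef]; exact mul_le_mul_of_nonneg_left (le_succ_sq _ (by positivity)) hε0
    linarith
  -- the mode: `j = ⌊√K/c₀⌋ + 1`, `K = Cρ/δ`, `k = c₀ j`
  obtain ⟨K, hK⟩ : ∃ K : ℝ, K = C * ρ / δ := ⟨_, rfl⟩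
  have hK0 : 0 ≤ K := by rw [hK]; positivity
  obtain ⟨j, hj⟩ : ∃ j : ℕ, j = ⌊Real.sqrt K / c₀⌋₊ + 1 := ⟨_, rfl⟩
  have hj0 : 0 < j := by rw [hj]; exact Nat.succ_pos _
  obtain ⟨m, hmdef⟩ : ∃ m : Fin 3 → ℤ, m = Pi.single (0 : Fin 3) ((j : ℕ) : ℤ) := ⟨_, rfl⟩
  have hm : m ≠ 0 := by
    intro h0
    have := congr_fun h0 0
    rw [hmdef, Pi.single_eq_same, Pi.zero_apply] at this
    exact hj0.ne' (by exact_mod_cast this)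
  have hkn : ‖((2 * Real.pi / L) • latticeVec 1 m)‖ = c₀ * j := by
    rw [hmdef, hc₀]
    exact norm_smul_latticeVec_single (by positivity) j
  obtain ⟨k, hkdef⟩ : ∃ k : ℝ, k = c₀ * j := ⟨_, rfl⟩
  rw [← hkdef] at hkn
  have hjlow : Real.sqrt K / c₀ < j := by rw [hj]; push_cast; exact Nat.lt_floor_add_one _
  have hjup : (j : ℝ) ≤ Real.sqrt K / c₀ + 1 := by
    rw [hj]; push_cast; gcongr; exact Nat.floor_le (by positivity)
  have hklow : Real.sqrt K < k := by
    rw [div_lt_iff₀ hc₀0] at hjlow; rw [hkdef]; linarith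
  have hk0 : 0 < k := lt_of_le_of_lt (Real.sqrt_nonneg K) hklow
  have hkup : k ≤ Real.sqrt K + c₀ := by
    have := mul_le_mul_of_nonneg_left hjup hc₀0.le
    rw [hkdef]
    calc c₀ * j ≤ c₀ * (Real.sqrt K / c₀ + 1) := this
      _ = Real.sqrt K + c₀ := by field_simp
  have hsqK : Real.sqrt K ^ 2 = K := Real.sq_sqrt hK0
  have hK_lt : K < k ^ 2 := by
    rw [← hsqK]
    exact pow_lt_pow_left₀ hklow (Real.sqrt_nonneg K) two_ne_zero
  have hCρ : C * ρ < k ^ 2 * δ := by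
    have : C * ρ = K * δ := by rw [hK]; field_simp
    rw [this]
    exact mul_lt_mul_of_pos_right hK_lt hδ0
  have hk2 : k ^ 2 ≤ 2 * K + 2 * c₀ ^ 2 := by
    have h0 := sq_le_two_sq_add_two_sq hk0.le hkup
    rwa [hsqK] at h0
  -- real-arithmetic energy budget: `2 ε² N³ k² ≤ η A ≤ δr`
  have hEreal : 2 * ε ^ 2 * ((n : ℝ) + 1) ^ 3 * k ^ 2 ≤ δr := by
    have hx0 : 0 ≤ 2 * ε ^ 2 * ((n : ℝ) + 1) ^ 3 := by positivity
    have h1 : 2 * ε ^ 2 * ((n : ℝ) + 1) ^ 3 * k ^ 2 ≤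
        2 * ε ^ 2 * ((n : ℝ) + 1) ^ 3 * (2 * K) + 2 * ε ^ 2 * ((n : ℝ) + 1) ^ 3 * (2 * c₀ ^ 2) := by
      rw [← mul_add]; exact mul_le_mul_of_nonneg_left hk2 hx0
    have h2 : 2 * ε ^ 2 * ((n : ℝ) + 1) ^ 3 * (2 * K) ≤ 8 * η * (C * ρ) := by
      have he : 2 * ε ^ 2 * ((n : ℝ) + 1) ^ 3 * (2 * K) =
          4 * η * (C * ρ) * (((n : ℝ) + 1) / n) := by
        rw [hK, hδdef, ← hεN]
        field_simp
        ring
      rw [he]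
      have h3 : ((n : ℝ) + 1) / n ≤ 2 := by rw [div_le_iff₀ (by positivity)]; linarith
      have h4 : 0 ≤ 4 * η * (C * ρ) := by positivity
      calc 4 * η * (C * ρ) * (((n : ℝ) + 1) / n) ≤ 4 * η * (C * ρ) * 2 :=
            mul_le_mul_of_nonneg_left h3 h4
        _ = 8 * η * (C * ρ) := by ring
    have h3 : 2 * ε ^ 2 * ((n : ℝ) + 1) ^ 3 * (2 * c₀ ^ 2) ≤ 4 * η * c₀ ^ 2 := by
      have he : 2 * ε ^ 2 * ((n : ℝ) + 1) ^ 3 * (2 * c₀ ^ 2) =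
          4 * c₀ ^ 2 * (η * (η / ((n : ℝ) + 1))) := by
        rw [← hεN]; field_simp; ring
      rw [he]
      have h5 : η / ((n : ℝ) + 1) ≤ 1 := by
        rw [div_le_one (by positivity)]; linarith
      have h6 : η * (η / ((n : ℝ) + 1)) ≤ η := by
        calc η * (η / ((n : ℝ) + 1)) ≤ η * 1 := mul_le_mul_of_nonneg_left h5 hη0.le
          _ = η := mul_one η
      calc 4 * c₀ ^ 2 * (η * (η / ((n : ℝ) + 1))) ≤ 4 * c₀ ^ 2 * η :=
            mul_le_mul_of_nonneg_left h6 (by positivity)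
        _ = 4 * η * c₀ ^ 2 := by ring
    have h7 : 8 * η * (C * ρ) + 4 * η * c₀ ^ 2 = η * A := by rw [hA]; ring
    linarith
  -- the witness and its energy
  have hE : periodicEnergy (0 : ℝ → ℝ≥0∞) (witnessState hε0 hεa hL hm) ≤
      periodicGroundStateEnergy (0 : ℝ → ℝ≥0∞) (n + 1) L + δ' := by
    rw [periodicGroundStateEnergy_zero_eq_zero (n + 1) hL, zero_add]
    refine (periodicEnergy_witnessState_le hε0 hεa hL hm).trans (le_trans ?_ hδr')
    refine ENNReal.ofReal_le_ofReal ?_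
    rw [hkn]
    push_cast
    exact hEreal
  -- evaluate the near-minimiser inequality on the witness
  have hw := key (witnessState hε0 hεa hL hm) hE (periodicEnergy_zero_ne_top _)
    (witnessState_real hε0 hεa hL hm) (witnessState_ne_zero hε0 hεa hL hm) m hm
  dsimp only at hw
  rw [structureFactor_witnessState_succ' hL n hε0 hεa hm, hkn, ← hδdef] at hw
  -- `k/√(k² + Cρ) ≤ 1 - δ` contradicts `Cρ < k²δ`
  have hsq : 0 < Real.sqrt (k ^ 2 + C * ρ) := Real.sqrt_pos.2 (by positivity)
  rw [div_le_iff₀ hsq] at hw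
  have h3 : k ^ 2 ≤ ((1 - δ) * Real.sqrt (k ^ 2 + C * ρ)) ^ 2 :=
    pow_le_pow_left₀ hk0.le hw 2
  rw [mul_pow, Real.sq_sqrt (by positivity)] at h3
  exact floor_contradiction hk0 hδ0 hδ1 (by positivity) hCρ h3

end Summit.AtomisticToContinuum.BoseEinsteinCondensation.Theorems.PuffFloor.Negative

end
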